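import Summits.QuantumFields.YangMills.Theorems.UnitScaleTiltProp7ResumPartPackaged
import Summits.QuantumFields.YangMills.Theorems.UnitScaleTiltProp7ConjCoeffRows
import HarnessLib

/-!
# Prop 7, route-R E′, (E1-c) brick F4d(ii) — THE `P₁ = u·B·u* − B` PIECE UNDER `ℓ²D*_W`, DIVERGENCE-LIPSCHITZ ROW IN `u`: `≤ 2‖u(x)−u′(x)‖·ℓ²‖D*B(x)‖ + 4|ι|ℓ²(δᵘ_d + 4δᵘ′mᵘ_d)β`

Route `UnitScaleTilt`, crux K1 child «MinimiserStabilityRegPr» (`stmt-QuantumFields-19200`), cell ym3-torus, width seat px15 (gen 2); pen «px15 g2: (E1-c) GO-LOCATE» (★p1 g15,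
2026-08-28T20:45:05Z), LOCATE `LOCATE-E1C-DIVLIPSCHITZ-px15g2.md` §6 (F4: `P₁` of F2 ✓p668882's trisection).  THEOREMS ONLY (0 `def`, 0 `sorry`); `--supports stmt-QuantumFields-19200`,
count-neutral.  YM₃ on T³ is a ladder rung (R3), not the Clay problem; nothing here claims the stub, the crux, d = 4 or the mass gap.

WHAT.  `P₁(u;B) := u·B·u* − B` at a bond, `u = u(y)` the unitary `e^{c•ψ(y)}` at the bond's base, `B` the DATA chart `log E` (the same for `ψ` and `ψ′`).  F4c(ii) ✓p672165
`norm_divB_coeffDiff_le` with the coefficient `ĉ₁(a)Z = aZa* − Z` (rows F4d(i) ⧗p673871 on the unit ball: `κ = 2`, `θ = 4`, *-equivariance) and `B′ = B` gives — the two `B − B′` terms vanish —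
  ★★★ `norm_divB_conjPiece_sub_le`: `ℓ²‖D*[P₁(u;B) − P₁(u′;B)](x)‖ ≤ 2·‖u x − u′ x‖·(ℓ²‖D*B(x)‖) + 4|ι|·ℓ²·(δᵘ_d + 4δᵘ′·mᵘ_d)·β`
for `‖u‖,‖u′‖ ≤ 1`, `‖u − u′‖ ≤ mᵘ_d`, `‖D_μu′‖ ≤ δᵘ′`, `‖D_μ(u − u′)‖ ≤ δᵘ_d`, `‖B‖ ≤ β`; transports norm-preserving and *-compatible (`R(U)⁻¹(M*) = (R(U)⁻¹M)*`, i.e. unitary).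
No pinned-cone junction is needed here: `ℓ²‖D*B‖ ≤ ‖D‴‖_Y` is a DATA row.  F4d(iii) converts the `u`-rows into `ψ`-rows (`mᵘ_d ≤ e^{R₀}m_d`, `δᵘ ≤ e^{R₀}δ`, `δᵘ_d ≤ e^{R₀}(δ_d + 2δ′m_d)`).
HONEST SCOPE.  Assembly ([folklore]).

References: T. Bałaban, CMP 98 (1985) 17–51 [Balaban1985Averaging] ((19)–(21) p.21); CMP 99 (1985) 389–434 [Balaban1985BackgroundPropagators] ((3.8) p.392).
-/

set_option autoImplicit false

noncomputable section

open scoped BigOperators Matrix.Norms.L2Operator Matrix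
open NormedSpace

namespace Summit.QuantumFields.YangMills.Theorems.Prop7ConjPieceDivLipschitz

open Literature.MathematicalPhysics.QuantumFieldTheory.Balaban1983to89
open Finset
open B9Eq39Adjoint (R R_def R_add R_sub covD covDstar divB)
open Summit.QuantumFields.YangMills.Theorems.Prop7ResumTermDivLipschitz (norm_divB_coeffDiff_le divB_sub covDstar_sub norm_transport_site_eq)
open Summit.QuantumFields.YangMills.Theorems.Prop7ResumPartPackaged (norm_covDstar_eq_norm_covD)
open Summit.QuantumFields.YangMills.Theorems.Prop7ConjCoeffRows (conjCoeff_map_sub conjCoeff_map_sum conjCoeff_equivariant norm_conjCoeff_sub_le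
  norm_conjCoeff_secondDiff_le)

variable {n : Type*} [Fintype n] [DecidableEq n] [Nonempty n]
variable {S : Type*} {ι : Type*} [Fintype ι] (T : ι → Equiv.Perm S) (U : ι → S → (Matrix n n ℂ)ˣ)

omit [Nonempty n] [Fintype ι] in
/-- `R(u)` is multiplicative. [folklore] -/
theorem R_mul' (u : (Matrix n n ℂ)ˣ) (X Y : Matrix n n ℂ) : R u (X * Y) = R u X * R u Y := by
  simp only [R, mul_assoc, Units.inv_mul_cancel_left]

omit [Nonempty n] in
/-- `D*` of the zero datum vanishes; hence `‖D*_μf x‖ ≤ ‖D_μ f(x−e_μ)‖`-type rows transfer. (bookkeeping) [folklore] -/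
theorem divB_zero' (x : S) : divB T U (fun (_ : ι) (_ : S) => (0 : Matrix n n ℂ)) x = 0 := by
  simp [divB, covDstar, R]

omit [Nonempty n] in
/-- ★★★ **THE `P₁` PIECE UNDER `ℓ²D*`, LIPSCHITZ IN `u`** (see the module docstring). [cite: Balaban1985Averaging, (19)-(21) p.21] [cite: Balaban1985BackgroundPropagators, (3.8) p.392] -/
theorem norm_divB_conjPiece_sub_le
    (hRn : ∀ μ x (M : Matrix n n ℂ), ‖R (U μ x)⁻¹ M‖ = ‖M‖) (hstar : ∀ μ x (M : Matrix n n ℂ), R (U μ x)⁻¹ (star M) = star (R (U μ x)⁻¹ M))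
    (u u' : S → Matrix n n ℂ) (hu : ∀ y, ‖u y‖ ≤ 1) (hu' : ∀ y, ‖u' y‖ ≤ 1) {mud δu' δud β : ℝ}
    (hmud : ∀ y, ‖u y - u' y‖ ≤ mud) (hδu'0 : 0 ≤ δu') (hδu' : ∀ μ y, ‖covD T U μ u' y‖ ≤ δu')
    (hδud : ∀ μ y, ‖covD T U μ (fun z => u z - u' z) y‖ ≤ δud) (B : ι → S → Matrix n n ℂ) (hβ : ∀ μ y, ‖B μ y‖ ≤ β) (ℓ : ℕ) (x : S) :
    (ℓ : ℝ) ^ 2 * ‖divB T U (fun μ y => (u y * B μ y * star (u y) - B μ y) - (u' y * B μ y * star (u' y) - B μ y)) x‖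
      ≤ 2 * ‖u x - u' x‖ * ((ℓ : ℝ) ^ 2 * ‖divB T U B x‖) + 4 * (Fintype.card ι : ℝ) * (ℓ : ℝ) ^ 2 * ((δud + 4 * δu' * mud) * β) := by
  have hmud0 : 0 ≤ mud := (norm_nonneg _).trans (hmud x)
  -- F4c(ii) with ĉ₁, R₀ = 1, κ = 2, θ = 4, B′ = B
  have hmain := norm_divB_coeffDiff_le T U hRn (fun a Z => a * Z * star a - Z)
    (fun a Z Z' => conjCoeff_map_sub a Z Z')
    (fun a f => conjCoeff_map_sum Finset.univ a f)
    (fun μ y a Z => conjCoeff_equivariant (R (U μ y)⁻¹) (R_mul' (U μ y)⁻¹) (R_sub (U μ y)⁻¹) (hstar μ y) a Z)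
    (R₀ := 1) (κ := 2) (θ := 4)
    (fun a b Z ha hb => norm_conjCoeff_sub_le ha hb Z)
    (fun a b a' b' Z ha hb _ hb' => norm_conjCoeff_secondDiff_le ha hb hb' Z)
    u u' hu hu' B B x
  beta_reduce at hmain
  have hBB : (fun μ y => B μ y - B μ y) = fun (_ : ι) (_ : S) => (0 : Matrix n n ℂ) := by funext μ y; exact sub_self _
  rw [hBB, divB_zero'] at hmain
  simp only [mul_zero, zero_mul, sub_self, norm_zero, zero_add, Finset.sum_const_zero, add_zero] at hmain
  -- the site term
  have hsite : ‖u x * divB T U B x * star (u x) - divB T U B x - (u' x * divB T U B x * star (u' x) - divB T U B x)‖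
      ≤ 2 * ‖u x - u' x‖ * ‖divB T U B x‖ := norm_conjCoeff_sub_le (hu x) (hu' x) _
  -- the four-point sum
  have hDs' : ∀ μ, ‖covDstar T U μ u' x‖ ≤ δu' := fun μ => by
    rw [norm_covDstar_eq_norm_covD T U hRn]; exact hδu' μ _
  have hDsd : ∀ μ, ‖covDstar T U μ u x - covDstar T U μ u' x‖ ≤ δud := fun μ => by
    rw [← covDstar_sub, norm_covDstar_eq_norm_covD T U hRn]; exact hδud μ _
  have h4 : 4 * ∑ μ, (‖covDstar T U μ u x - covDstar T U μ u' x‖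
        + 2 * ‖covDstar T U μ u' x‖ * (‖u ((T μ).symm x) - u' ((T μ).symm x)‖ + ‖u x - u' x‖)) * ‖B μ ((T μ).symm x)‖
      ≤ 4 * (Fintype.card ι * ((δud + 4 * δu' * mud) * β)) := by
    refine mul_le_mul_of_nonneg_left ?_ (by norm_num)
    calc _ ≤ ∑ _μ : ι, (δud + 4 * δu' * mud) * β := Finset.sum_le_sum fun μ _ => by
            have ha : ‖covDstar T U μ u x - covDstar T U μ u' x‖
                + 2 * ‖covDstar T U μ u' x‖ * (‖u ((T μ).symm x) - u' ((T μ).symm x)‖ + ‖u x - u' x‖) ≤ δud + 4 * δu' * mud := by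
              have hb : 2 * ‖covDstar T U μ u' x‖ * (‖u ((T μ).symm x) - u' ((T μ).symm x)‖ + ‖u x - u' x‖) ≤ 2 * δu' * (mud + mud) :=
                mul_le_mul (mul_le_mul_of_nonneg_left (hDs' μ) (by norm_num)) (add_le_add (hmud _) (hmud _)) (by positivity) (by positivity)
              linarith [hDsd μ]
            exact mul_le_mul ha (hβ μ _) (norm_nonneg _) (add_nonneg ((norm_nonneg _).trans (hDsd μ)) (by positivity))
      _ = Fintype.card ι * ((δud + 4 * δu' * mud) * β) := by rw [Finset.sum_const, nsmul_eq_mul, Finset.card_univ]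
  have hℓ2 : 0 ≤ (ℓ : ℝ) ^ 2 := sq_nonneg _
  have := mul_le_mul_of_nonneg_left (hmain.trans (add_le_add hsite h4)) hℓ2
  refine this.trans (le_of_eq ?_)
  ring

end Summit.QuantumFields.YangMills.Theorems.Prop7ConjPieceDivLipschitz

end
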